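import Summits.QuantumFields.QCD.Cruxes.NegativeCellsDilute.Disproof

/-!
# drefute evidence — `stub_pinnedStripLaw` (transfer C⁺ of line `mass-wegner-cell-index`, crux stmt-QuantumFields-13900)
# carries NO content beyond the pin on a high line: `HighLinePin → stub_pinnedStripLaw`

The disprover's sandwich (`Disproof.lean` § 4, `crux_of_highLinePin`) for the crux extends verbatim to the line's open stub:
along any admissible line keeping every valence mass positive (`mcrit k ≥ −a_k M₀/Z_m k`), clause (a⁺) (windowed STRIP law)
holds with `δ ≡ 0` and `η := ½ min_f m_f(k)`, because every strip `Icc (m_f(k)) (η − edge(s))` is EMPTY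
(`η − edge(s) < η < m_f(k)`, `edge(s) ≥ 0`).  So, exactly as for the crux, the whole content of C⁺ beyond the bare pin (b)
is "no high line carries the pin".  (Refuter evidence; not a refutation; rc 0, no sorry.)
-/

noncomputable section

namespace Summit.QuantumFields.QCD.Cruxes.NegativeCellsDilute.MassWegnerCellIndex.Refuter

open scoped BigOperators ENNReal Classical
open MeasureTheory Filter
open Literature.MathematicalPhysics.QuantumLattice Literature.MathematicalPhysics.QuantumFieldTheory
  Literature.Probability.LatticeModels
open Summit.QuantumFields.QCD.Cruxes.NegativeCellsDilute.Disproof (HighLinePin PinClause)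

/-- `stub_pinnedStripLaw` of the lead's skeleton, verbatim, as a named proposition. -/
def PinnedStripLaw : Prop :=
    ∀ Nf : ℕ, (Nf = 2 ∨ Nf = 3) → ∃ reg : QCDRegularisation Nf, reg.HasMassScaling ∧
      (reg.scheme 0 0 0).HasAsymptoticScaling ∧ ∃ M₀ : ℝ, 0 ≤ M₀ ∧ ∃ b₀ : ℕ, 2 ≤ b₀ ∧ ∃ ℓ : ℝ, 0 < ℓ ∧
      ∀ m : Fin Nf → ℝ, (∀ f, M₀ < m f) → ∃ R : ℝ, 0 < R ∧
      (∀ ε : ℝ, 0 < ε → ∀ᶠ k : ℕ in Filter.atTop, ∀ S : ℕ, R ≤ reg.a k * (2 * S + 1) →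
        ∃ η : ℝ, 0 < η ∧ ∃ δ : ℕ → ℝ, (∀ j, 0 ≤ δ j) ∧
          ∑ j ∈ Finset.range (Nat.log 2 (⌊ℓ / reg.a k⌋₊ / b₀) + 1), δ j ≤ ε ∧
          ∀ j < Nat.log 2 (⌊ℓ / reg.a k⌋₊ / b₀) + 1, ∀ s : Fin 4 → ℕ,
            (∀ i, b₀ * 2 ^ j ≤ s i ∧ s i < b₀ * 2 ^ (j + 2) ∧ s i ≤ 2 * S + 1 ∧ (s i : ℝ) * reg.a k ≤ ℓ) →
            η⁻¹ * ∑ f, (∫⁻ μ' in Set.Icc (reg.mcrit k + reg.a k * m f / reg.Zm k) (η - ∑ i, (1 - Real.cos (Real.pi / s i))),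
              ENNReal.ofReal
                ((∫ U : GaugeConfig 4 (2 * S + 1) (Matrix.specialUnitaryGroup (Fin 3) ℂ), (if ((∃ v : {p // wilsonBox (0 : TorusSite 4 (2 * S + 1)) s p} → ℂ, v ≠ 0 ∧
                      ∑ p, ‖(wilsonCell U μ' 0 s).mulVec v p‖ ^ 2 < η ^ 2 * ∑ p, ‖v p‖ ^ 2) ∨
                    ∃ c : Fin 4 → Bool, ∃ v : {p // wilsonBox (halfCorner s c : TorusSite 4 (2 * S + 1)) (halfSides s c) p} → ℂ,
                      v ≠ 0 ∧ ∑ p, ‖(wilsonCell U μ' (halfCorner s c) (halfSides s c)).mulVec v p‖ ^ 2 <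
                        η ^ 2 * ∑ p, ‖v p‖ ^ 2) then (1 : ℝ) else 0) *
                      ∏ f, ‖fermionDet (wilsonDirac (fundamentalRep (Fin 3)) U (reg.mcrit k + reg.a k * m f / reg.Zm k) 1)‖ ∂(wilsonMeasure (fundamentalRep (Fin 3)) (reg.β k))) /
                  (∫ U : GaugeConfig 4 (2 * S + 1) (Matrix.specialUnitaryGroup (Fin 3) ℂ),
                      ∏ f, ‖fermionDet (wilsonDirac (fundamentalRep (Fin 3)) U (reg.mcrit k + reg.a k * m f / reg.Zm k) 1)‖ ∂(wilsonMeasure (fundamentalRep (Fin 3)) (reg.β k))))).toReal ≤ δ j) ∧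
      (∀ M : ℝ, M₀ < M → ∀ᶠ k : ℕ in Filter.atTop, ∀ S : ℕ, R ≤ reg.a k * (2 * S + 1) →
        (1 / 4 : ℝ) ≤
          (∫ U : GaugeConfig 4 (2 * S + 1) (Matrix.specialUnitaryGroup (Fin 3) ℂ), (if (fermionDet (wilsonDirac (fundamentalRep (Fin 3)) U (reg.mcrit k - reg.a k * M / reg.Zm k) 1)).re < 0 then (1 : ℝ) else 0) *
                ∏ f, ‖fermionDet (wilsonDirac (fundamentalRep (Fin 3)) U (reg.mcrit k + reg.a k * m f / reg.Zm k) 1)‖ ∂(wilsonMeasure (fundamentalRep (Fin 3)) (reg.β k))) /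
            (∫ U : GaugeConfig 4 (2 * S + 1) (Matrix.specialUnitaryGroup (Fin 3) ℂ),
                ∏ f, ‖fermionDet (wilsonDirac (fundamentalRep (Fin 3)) U (reg.mcrit k + reg.a k * m f / reg.Zm k) 1)‖ ∂(wilsonMeasure (fundamentalRep (Fin 3)) (reg.β k))))

/-- The kinetic edge of a box is non-negative. -/
theorem edge_nonneg (s : Fin 4 → ℕ) : 0 ≤ ∑ i, (1 - Real.cos (Real.pi / s i)) :=
  Finset.sum_nonneg fun i _ => by linarith [Real.cos_le_one (Real.pi / s i)]

/-- **`HighLinePin → stub_pinnedStripLaw`**: on a high line (all valence masses positive) the strip law (a⁺) holds with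
`δ ≡ 0`, `η = ½ min_f m_f(k)` (every strip is empty), and the pin is carried over verbatim. -/
theorem pinnedStripLaw_of_highLinePin (h : HighLinePin) : PinnedStripLaw := by
  intro Nf hNf
  obtain ⟨reg, hms, has, M₀, hM₀, hline, h⟩ := h Nf hNf
  refine ⟨reg, hms, has, M₀, hM₀, 2, le_rfl, 1, one_pos, fun m hm => ?_⟩
  obtain ⟨R, hR, hpin⟩ := h m hm
  refine ⟨R, hR, ?_, ?_⟩
  · intro ε hε
    refine Filter.Eventually.of_forall fun k S _ => ?_
    -- all valence masses are positive on a high line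
    have hpos : ∀ f, 0 < reg.mcrit k + reg.a k * m f / reg.Zm k := by
      intro f
      have h1 := hline k
      have h2 : reg.a k * M₀ / reg.Zm k < reg.a k * m f / reg.Zm k :=
        div_lt_div_of_pos_right (mul_lt_mul_of_pos_left (hm f) (reg.a_pos k)) (reg.Zm_pos k)
      linarith
    -- a flavour of least valence mass
    haveI : Nonempty (Fin Nf) := ⟨⟨0, by omega⟩⟩
    obtain ⟨f₀, -, hf₀⟩ := Finset.exists_min_image Finset.univ
      (fun f : Fin Nf => reg.mcrit k + reg.a k * m f / reg.Zm k) Finset.univ_nonempty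
    set η : ℝ := (reg.mcrit k + reg.a k * m f₀ / reg.Zm k) / 2 with hηdef
    have hη : 0 < η := by have := hpos f₀; positivity
    have hηlt : ∀ f, η < reg.mcrit k + reg.a k * m f / reg.Zm k := by
      intro f
      have := hf₀ f (Finset.mem_univ f)
      have := hpos f₀
      simp only [hηdef]
      linarith
    refine ⟨η, hη, fun _ => 0, fun _ => le_rfl, by simp [hε.le], ?_⟩
    intro j _ s _
    have hempty : ∀ f, Set.Icc (reg.mcrit k + reg.a k * m f / reg.Zm k)
        (η - ∑ i, (1 - Real.cos (Real.pi / s i))) = ∅ := by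
      intro f
      apply Set.Icc_eq_empty
      have := hηlt f
      have := edge_nonneg s
      linarith
    simp only [hempty, Measure.restrict_empty, lintegral_zero_measure, ENNReal.toReal_zero,
      Finset.sum_const_zero, mul_zero, le_refl]
  · simpa [PinClause] using hpin

end Summit.QuantumFields.QCD.Cruxes.NegativeCellsDilute.MassWegnerCellIndex.Refuter

end
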